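import Summits.MatrixMultiplication.OmegaCensus.STPPSmallPatternT1K9OrderLaw57
import Summits.MatrixMultiplication.OmegaCensus.STPPSmallPatternT1K12OrderLaw95
import Summits.MatrixMultiplication.OmegaCensus.STPPSmallPatternT1K13OrderLaw109
import Summits.MatrixMultiplication.OmegaCensus.STPPSmallPatternEvenOrderLift
import Summits.MatrixMultiplication.OmegaCensus.STPPSmallPatternCyclicFatLifts

/-!
# ω-census, small patterns `(1,2,2)^k` / `(2,2,2)^k`, `k = 9, 12, 13`: the fat lifts of the LOWERED `(2,1,1)^k` thresholds `57 / 95 / 109` (kernel)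

Cell `pub-omega`, ω construction census, seat pub-omega ENG2 (gen 39), 2026-08-30. HONEST FRAMING (verbatim): lottery ticket; floor =
certified bounds/negative ranges.  Census STRUCTURE bookkeeping (row B5, columns `T2` / `T3`; conjecture C10 (a) LIFT-TIGHT); nothing here bears on `ω`.
Template: ENG2 gen 37's `STPPSmallPatternT2LiftsN69N81N96N108` (p736319).

The `T1` column moved on 2026-08-30 (ENG2 gen 39, night-34 finds of kit GO #176 + the Cauchy device): law `k = 9` at `57`
(`exists_isSTPP_211pow9_of_card_ge_57`, cyclic ray from `57`), law `k = 12` at `95` (`exists_isSTPP_211pow12_of_card_ge_95`, ray from `95`), law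
`k = 13` at `109` (`exists_isSTPP_211pow13_of_card_ge_109`; ray from `108` unchanged, its lifts are in the template file).  The tree's lifts
(`exists_isSTPP_122pow_zmod_two_mul_of_211pow`, `exists_isSTPP_122_of_even_card_of_law`, `exists_isSTPP_222_of_four_dvd_card_of_law`) give at once:

* `k = 9`: `(1,2,2)⁹ ⊆ ℤ/2n` for `n ≥ 57` (record `n ≥ 58`, `STPPSmallPatternT2K9From116`); every abelian group of EVEN order `≥ 114` hosts `(1,2,2)⁹`
  (was `116`); order `≥ 228` divisible by `4` hosts `(2,2,2)⁹` (was `232`);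
* `k = 12`: `(1,2,2)¹² ⊆ ℤ/2n` for `n ≥ 95`; EVEN order `≥ 190` hosts `(1,2,2)¹²` (was `192`); order `≥ 380` divisible by `4` hosts `(2,2,2)¹²` (was `384`);
* `k = 13`: EVEN order `≥ 218` hosts `(1,2,2)¹³` (was `220`); order `≥ 436` divisible by `4` hosts `(2,2,2)¹³` (was `440`).

No sharpness claim anywhere.  References: H. Cohn, R. Kleinberg, B. Szegedy, C. Umans, FOCS 2005 (arXiv:math/0511460), Def. 5.1.
-/

open Literature.Computability.AlgebraicComplexity Finset

universe u

namespace Summit.MatrixMultiplication.OmegaCensus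

/-! ## `k = 9` (law at `57`) -/

/-- **`(1,2,2)⁹ ⊆ ℤ/2n` for every `n ≥ 57`** (fat lift of the cyclic `(2,1,1)⁹` ray from `57`; the record was `n ≥ 58`).
[cite: CohnKleinbergSzegedyUmans2005, Def. 5.1] -/
theorem exists_isSTPP_122pow9_zmod_two_mul_of_le57 (n : ℕ) (hn : 57 ≤ n) :
    ∃ A B C : Fin 9 → Finset (ZMod (2 * n)), IsSTPP A B C ∧ ∀ i, (A i).card = 1 ∧ (B i).card = 2 ∧ (C i).card = 2 :=
  haveI : NeZero n := ⟨by omega⟩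
  exists_isSTPP_122pow_zmod_two_mul_of_211pow (exists_isSTPP_211pow9_zmod_of_le57 n hn)

/-- **Every finite abelian group of even order `≥ 114` hosts `(1,2,2)⁹`** (even-order lift of the `(2,1,1)⁹` law at `57`; the record was `116`).
[cite: CohnKleinbergSzegedyUmans2005, Def. 5.1] -/
theorem exists_isSTPP_122pow9_of_even_card_ge_114 {G : Type u} [AddCommGroup G] [Finite G] (heven : Even (Nat.card G))
    (hG : 114 ≤ Nat.card G) :
    ∃ A B C : Fin 9 → Finset G, IsSTPP A B C ∧ ∀ i, (A i).card = 1 ∧ (B i).card = 2 ∧ (C i).card = 2 :=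
  exists_isSTPP_122_of_even_card_of_law (N := 57) (fun Q _ _ hQ => exists_isSTPP_211pow9_of_card_ge_57 hQ) heven (by omega)

/-- Every finite abelian group of order `≥ 228` divisible by `4` hosts `(2,2,2)⁹` (double lift of the `(2,1,1)⁹` law at `57`; the record was `232`).
[cite: CohnKleinbergSzegedyUmans2005, Def. 5.1] -/
theorem exists_isSTPP_222pow9_of_four_dvd_card_ge_228 {G : Type u} [AddCommGroup G] [Finite G] (h4 : 4 ∣ Nat.card G)
    (hG : 228 ≤ Nat.card G) :
    ∃ A B C : Fin 9 → Finset G, IsSTPP A B C ∧ ∀ i, (A i).card = 2 ∧ (B i).card = 2 ∧ (C i).card = 2 :=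
  exists_isSTPP_222_of_four_dvd_card_of_law (N := 57) (fun Q _ _ hQ => exists_isSTPP_211pow9_of_card_ge_57 hQ) h4 (by omega)

/-! ## `k = 12` (law at `95`) -/

/-- **`(1,2,2)¹² ⊆ ℤ/2n` for every `n ≥ 95`** (fat lift of the cyclic `(2,1,1)¹²` ray from `95`). [cite: CohnKleinbergSzegedyUmans2005, Def. 5.1] -/
theorem exists_isSTPP_122pow12_zmod_two_mul_of_le95 (n : ℕ) (hn : 95 ≤ n) :
    ∃ A B C : Fin 12 → Finset (ZMod (2 * n)), IsSTPP A B C ∧ ∀ i, (A i).card = 1 ∧ (B i).card = 2 ∧ (C i).card = 2 :=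
  haveI : NeZero n := ⟨by omega⟩
  exists_isSTPP_122pow_zmod_two_mul_of_211pow (exists_isSTPP_211pow12_zmod_of_le95 n hn)

/-- **Every finite abelian group of even order `≥ 190` hosts `(1,2,2)¹²`** (even-order lift of the `(2,1,1)¹²` law at `95`; the record was `192`).
[cite: CohnKleinbergSzegedyUmans2005, Def. 5.1] -/
theorem exists_isSTPP_122pow12_of_even_card_ge_190 {G : Type u} [AddCommGroup G] [Finite G] (heven : Even (Nat.card G))
    (hG : 190 ≤ Nat.card G) :
    ∃ A B C : Fin 12 → Finset G, IsSTPP A B C ∧ ∀ i, (A i).card = 1 ∧ (B i).card = 2 ∧ (C i).card = 2 :=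
  exists_isSTPP_122_of_even_card_of_law (N := 95) (fun Q _ _ hQ => exists_isSTPP_211pow12_of_card_ge_95 hQ) heven (by omega)

/-- Every finite abelian group of order `≥ 380` divisible by `4` hosts `(2,2,2)¹²` (double lift of the `(2,1,1)¹²` law at `95`; the record was `384`).
[cite: CohnKleinbergSzegedyUmans2005, Def. 5.1] -/
theorem exists_isSTPP_222pow12_of_four_dvd_card_ge_380 {G : Type u} [AddCommGroup G] [Finite G] (h4 : 4 ∣ Nat.card G)
    (hG : 380 ≤ Nat.card G) :
    ∃ A B C : Fin 12 → Finset G, IsSTPP A B C ∧ ∀ i, (A i).card = 2 ∧ (B i).card = 2 ∧ (C i).card = 2 :=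
  exists_isSTPP_222_of_four_dvd_card_of_law (N := 95) (fun Q _ _ hQ => exists_isSTPP_211pow12_of_card_ge_95 hQ) h4 (by omega)

/-! ## `k = 13` (law at `109`) -/

/-- **Every finite abelian group of even order `≥ 218` hosts `(1,2,2)¹³`** (even-order lift of the `(2,1,1)¹³` law at `109`; the record was `220`).
[cite: CohnKleinbergSzegedyUmans2005, Def. 5.1] -/
theorem exists_isSTPP_122pow13_of_even_card_ge_218 {G : Type u} [AddCommGroup G] [Finite G] (heven : Even (Nat.card G))
    (hG : 218 ≤ Nat.card G) :
    ∃ A B C : Fin 13 → Finset G, IsSTPP A B C ∧ ∀ i, (A i).card = 1 ∧ (B i).card = 2 ∧ (C i).card = 2 :=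
  exists_isSTPP_122_of_even_card_of_law (N := 109) (fun Q _ _ hQ => exists_isSTPP_211pow13_of_card_ge_109 hQ) heven (by omega)

/-- Every finite abelian group of order `≥ 436` divisible by `4` hosts `(2,2,2)¹³` (double lift of the `(2,1,1)¹³` law at `109`; the record was `440`).
[cite: CohnKleinbergSzegedyUmans2005, Def. 5.1] -/
theorem exists_isSTPP_222pow13_of_four_dvd_card_ge_436 {G : Type u} [AddCommGroup G] [Finite G] (h4 : 4 ∣ Nat.card G)
    (hG : 436 ≤ Nat.card G) :
    ∃ A B C : Fin 13 → Finset G, IsSTPP A B C ∧ ∀ i, (A i).card = 2 ∧ (B i).card = 2 ∧ (C i).card = 2 :=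
  exists_isSTPP_222_of_four_dvd_card_of_law (N := 109) (fun Q _ _ hQ => exists_isSTPP_211pow13_of_card_ge_109 hQ) h4 (by omega)

end Summit.MatrixMultiplication.OmegaCensus
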